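import Mathlib
import HarnessLib
import Summits.NavierStokesRegularity.NavierStokesRegularity.Theses.TypeILiouville
import Summits.NavierStokesRegularity.NavierStokesRegularity.Theses.EulerZoomLiouville

/-!
# Route `EulerZoomLiouville` (№10): calibration of the residual `TypeIOrPowerZoomable` against the hard core
# `TypeIliouvilleNoTypeII` (stmt-NavierStokesRegularity-0056)

Helper file (theorems only; `--supports stmt-NavierStokesRegularity-19833 --as helper`). Seat ns-typeII-p3
(cell ns-regularity-ideate §B, D-0081). Pure logic on the born Theses decls; no analysis.

The route's rationale declares R₁ = `TypeIOrPowerZoomable` (stmt-NavierStokesRegularity-19833) a RESIDUAL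
«strictly weaker than stmt-0056» and the deciding theorem `closes` runs `E → Z → R₁ → (L) → Clay (A)`.
This file records, BY NAME, the two placements behind those words:
* `typeIOrPowerZoomable_of_noTypeII` — R₁ ⇐ stmt-0056 (`TypeILiouville.TypeIliouvilleNoTypeII`: a first
  blow-up is Type I), by the left disjunct: R₁ is at most as strong as the hard core;
* `noTypeII_of_conjuncts` — E ∧ Z ∧ R₁ ⇒ stmt-0056: WITHOUT the Liouville conjecture (L), the three №10
  conjuncts already settle the shared residual NoTypeII of the §B programme (the power-zoomable branch is
  killed by Z + E exactly as in `closes`; the Type I branch is the conclusion);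
* `typeIOrPowerZoomable_iff_noTypeII` — hence, GIVEN E and Z, the residual R₁ is EQUIVALENT to stmt-0056;
* `typeIliouvilleL_iff` — R₂ = `EulerZoomLiouville.TypeIliouvilleL` is verbatim the shared item
  `TypeILiouville.TypeIliouvilleL` (stmt-NavierStokesRegularity-10661).
So №10 factors through the hard core: (E ∧ Z) ⊢ R₁ ↔ NoTypeII, and NoTypeII ∧ (L) ⊢ Clay (A) is route
`TypeILiouville`.  WHAT THIS IS NOT: not NS, not progress on E, Z, R₁, (L) or stmt-0056 — bookkeeping
implications between OPEN statements. [folklore]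
-/

noncomputable section

-- the summit and its single sub-problem share the name (CONVENTIONS §1), as in every Theorems file
set_option linter.dupNamespace false

namespace Summit.NavierStokesRegularity.NavierStokesRegularity.Theorems.EulerZoomLiouvilleResidualCalibration

open Summit.NavierStokesRegularity.NavierStokesRegularity.Theses

/-- **R₁ ⇐ stmt-0056**: if every first blow-up is Type I (`TypeILiouville.TypeIliouvilleNoTypeII`), then
`EulerZoomLiouville.TypeIOrPowerZoomable` holds by its left disjunct. [folklore] -/
theorem typeIOrPowerZoomable_of_noTypeII (h : TypeILiouville.TypeIliouvilleNoTypeII) :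
    EulerZoomLiouville.TypeIOrPowerZoomable :=
  fun ν T hν hT u p hmax hLH hdec => Or.inl (h ν T hν hT u p hmax hLH hdec)

/-- **E ∧ Z ∧ R₁ ⇒ stmt-0056** (no Liouville conjecture needed): at a first blow-up, R₁ gives Type I or a
power-zoomable point; in the second case Z produces a nontrivial member of the power-gauged Euler class
and E says it is zero — contradiction; so the blow-up is Type I. [folklore] -/
theorem noTypeII_of_conjuncts (hE : EulerZoomLiouville.PowerGaugeEulerLiouville)
    (hZ : EulerZoomLiouville.SereginZoomReduction) (hR : EulerZoomLiouville.TypeIOrPowerZoomable) :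
    TypeILiouville.TypeIliouvilleNoTypeII := by
  intro ν T hν hT u p hmax hLH hdec
  rcases hR ν T hν hT u p hmax hLH hdec with hI | ⟨x₀, q, G, r₀, ρ, hρ, hρ', hr₀, hsw, hG, hM, hfloor⟩
  · exact hI
  · obtain ⟨U, P, H, c, hU, hH, hclass, hne⟩ :=
      hZ ρ hρ hρ' r₀ (ν * T, x₀) (fun s y => ν⁻¹ • u (s / ν) y) q G hr₀ hsw hG hM hfloor
    exact absurd (hE ρ hρ U P H c hU hH hclass) hne

/-- **Given E and Z, the residual R₁ is equivalent to stmt-0056.** [folklore] -/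
theorem typeIOrPowerZoomable_iff_noTypeII (hE : EulerZoomLiouville.PowerGaugeEulerLiouville)
    (hZ : EulerZoomLiouville.SereginZoomReduction) :
    EulerZoomLiouville.TypeIOrPowerZoomable ↔ TypeILiouville.TypeIliouvilleNoTypeII :=
  ⟨noTypeII_of_conjuncts hE hZ, typeIOrPowerZoomable_of_noTypeII⟩

/-- **R₂ is verbatim the shared item (L)** of route `TypeILiouville` (stmt-NavierStokesRegularity-10661). [folklore] -/
theorem typeIliouvilleL_iff :
    EulerZoomLiouville.TypeIliouvilleL ↔ TypeILiouville.TypeIliouvilleL :=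
  Iff.rfl

end Summit.NavierStokesRegularity.NavierStokesRegularity.Theorems.EulerZoomLiouvilleResidualCalibration

end
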